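/-
Copyright (c) 2026 the pub-hodgecm-mathlib formalisation cell (harness21).  Prover seat hodgecm-mathlib-K2E3-p23 (g8), Track B «K2-LIT» ∕ hLiu418 #184♮,
Road I v3, unit U5 «THE CLOSE», FACE-D₀ row `h2₂`: THE LOCAL UNIPOTENT CHART at one finite place `v` (the input of the S-letter `hb` of ★ p863332, self-named on the
OWED §2 of ★ p863351 `K2LiuFirstTermLineLiftRankRowSmallLetters`, LEAD F0P6-plan (g15) BATCH #181 (5) ∕ #183 (2)).  THEOREMS ONLY.
-/
import Summits.HodgeConjecture.HodgeConjecture.Theorems.K2LiuUnipotentChart                        -- ★ `exists_unipChart`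
import Summits.HodgeConjecture.HodgeConjecture.Theorems.K2LiuSiegelBigCellFree                      -- ★ `blk_eq_of_mem_unipDelta` (`blk u = (1 − X, X; −X, 1 + X)`)
import Summits.HodgeConjecture.HodgeConjecture.Theorems.K2LiuSiegelUnipotentCharacterFactorisation -- ★ (d1) §2: `map_fst_locToAdelic`, `map_adeleEval_locToAdelic_of_over ∕ _of_not_over`, `map_adeleEval_eq_evalPlace` (+ ★ Φ3b `unipDeltaLoc`)
import HarnessLib

/-!
# K2_Liu road (hLiu418 = stmt-HodgeConjecture-24832), U5 «THE CLOSE», FACE-D₀ row `h2₂`: THE LOCAL UNIPOTENT CHART — every admissible block `X` supported at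
# the places over ONE finite place `v` of `L⁺` is the coordinate of a LOCAL Siegel unipotent `z ∈ N_Δ(L⁺_v)`: `X(ι_v z) = X`

Cell `pub/hodgecm-mathlib` (D-0151), Track B, build stream 29; helper lane `--supports stmt-HodgeConjecture-24832 --as helper`, count-neutral; closes no socket.
THEOREMS ONLY (no `def`, no `instance`, no notation, no named-fact hypothesis, no `sorry`).

WHY.  ★ U2a's σ-explicit line model (★ p863332 `h2Row_thetaSide_of_finLineModel_conj`) has the letter `hb : ∀ s hermitian, ∃ z, b z = s` — the multiplier group `Z`
must EXHAUST the hermitian `2 × 2` matrices over `R = L ⊗ L⁺_v`.  With `Z := N_Δ(L⁺_v)` (★ p863351 §1.2–§1.3: `ι := locToAdelic v`, `χ := ψ_S ∘ ι`) and `b z` the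
hermitian dressing of the block coordinate `X(ι_v z)`, `hb` is the SURJECTIVITY of the block coordinate on local unipotents.  ★ `K2LiuUnipotentChart.exists_unipChart` is
the ADELIC chart `X ↦ n(X) ∈ N_Δ(𝔸)` (onto, for every `T_𝔸`-skew `X ∈ M_n(𝔸_L)`); THIS FILE localises it: if `X` is `T_𝔸`-skew with ZERO archimedean part and ZERO
components off the places over `v`, then `n(X) = ι_v z` for the local unipotent `z := (n(X)_f)_v ∈ N_Δ(L⁺_v)` (★ Φ3b `evalPlace_finPart_mem_unipDeltaLoc`), because both
sides have the same archimedean part (`1`) and the same component at every finite place (★ (d1) §2).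
* §1 (★ `K2LiuSiegelBigCellFree.blk_eq_of_mem_unipDelta`: `blk u = (1 − X, X; −X, 1 + X)`, `X = (blk u)₁₂`, for `u ∈ N_Δ(𝔸)`)
  **`coe_eq_reindex_fromBlocks_of_mem_unipDelta`** — the adelic matrix of `u`; `map_coe_eq_of_mem_unipDelta` (through any ring hom), `map_coe_eq_one_of_map_eq_zero`
  (a component where `X` vanishes is the identity matrix).
* §2 `matrix_adele_ext_of_places` — matrices over `𝔸_L` agree iff their archimedean parts and all finite-place components agree.
* §3 **`locToAdelic_evalPlace_finPart_eq_of_mem_unipDelta`** — for `u ∈ N_Δ(𝔸)` with `X(u)_∞ = 0` and `X(u)_w = 0` off `v`: `ι_v ((u_f)_v) = u`;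
  **`exists_mem_unipDeltaLoc_locToAdelic_eq`** — `∃ z ∈ N_Δ(L⁺_v), ι_v z = u`.
* §4 **`exists_mem_unipDeltaLoc_toBlocks₁₂_eq`** — THE LOCAL CHART: for every `T_𝔸`-skew `X ∈ M_n(𝔸_L)` supported at the places over `v` there is `z ∈ N_Δ(L⁺_v)` with
  `ι_v z ∈ N_Δ(𝔸)` and `X(ι_v z) = X` (★ adelic chart ∘ §3) — the `hb` input, in the coordinates of ★ (d1) `unipDeltaChar_locToAdelic_eq_prod`.
References: [GelbartPiatetskishapiroRallis1987] Part A §1 (`N = {n(X)}`); [MoeglinWaldspurger1995] I.2.1; [BorelJacquet1979] §4.1; [HarrisKudlaSweet1996] §1 (1.12);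
[CasselsFrohlichANT1967] Ch. II §14 (local components).
HONEST LABEL: HC_CM is proved only modulo the 7 printed citations (2 remaining named inputs: hLiu418 = stmt-HodgeConjecture-24832, h413 = stmt-HodgeConjecture-24833)
until rung 0 closes; this file moves no counter; `h2₂` NOT discharged.
-/

set_option autoImplicit false
set_option linter.dupNamespace false -- the mandated namespace repeats `HodgeConjecture.HodgeConjecture`

noncomputable section

open scoped Matrix RestrictedProduct
open NumberField IsDedekindDomain
open Literature.NumberTheory.Automorphic Literature.NumberTheory.Automorphic.UnitaryGroup Literature.NumberTheory.GaloisRepresentations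
open Literature.NumberTheory.GelbartRogawski1991 Literature.NumberTheory.GelbartRogawski1991.GRConstruction
open Literature.NumberTheory.K2Lit.SiegelDoubled

namespace Summit.HodgeConjecture.HodgeConjecture.Cruxes.HLiu418.K2LiuUnipotentChartLocal

open K2LiuSiegelUnipotentLocalDefs (unipDeltaLoc evalPlace_finPart_mem_unipDeltaLoc)
open K2LiuUnipotentChart (exists_unipChart)
open K2LiuSiegelUnipotentCharacterFactorisation (map_fst_locToAdelic map_adeleEval_locToAdelic_of_over map_adeleEval_locToAdelic_of_not_over map_adeleEval_eq_evalPlace)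

variable (L : Type) [Field L] [NumberField L] [IsCMField L]
variable {N M n : ℕ} (e : Fin N × Fin M ≃ Fin n)
  (dV : Fin N → L) (hdV : ∀ i, IsCMField.complexConj L (dV i) = dV i)
  (dW : Fin M → L) (hdW : ∀ i, IsCMField.complexConj L (dW i) = dW i)

/-! ## §1 The matrix of a Siegel unipotent from its block coordinate -/

/-- **THE ADELIC MATRIX OF A SIEGEL UNIPOTENT**: `u = reindex e₂ e₂ (1 − X, X; −X, 1 + X)`, `X = X(u) = (blk u)₁₂`. [cite: MoeglinWaldspurger1995, I.2.1] -/
theorem coe_eq_reindex_fromBlocks_of_mem_unipDelta {u : HA L e dV hdV dW hdW} (hu : u ∈ unipDelta L e dV hdV dW hdW) :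
    (((u : HA L e dV hdV dW hdW) : GL (Fin (n + n)) (AdeleRing (𝓞 L) L)) : Matrix (Fin (n + n)) (Fin (n + n)) (AdeleRing (𝓞 L) L)) =
      Matrix.reindex (e₂ (n := n)) (e₂ (n := n))
        (Matrix.fromBlocks (1 - (blk L e dV hdV dW hdW u).toBlocks₁₂) (blk L e dV hdV dW hdW u).toBlocks₁₂
          (-(blk L e dV hdV dW hdW u).toBlocks₁₂) (1 + (blk L e dV hdV dW hdW u).toBlocks₁₂)) := by
  rw [← K2LiuSiegelBigCellFree.blk_eq_of_mem_unipDelta L e dV hdV dW hdW hu]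
  exact ((Matrix.reindex (e₂ (n := n)) (e₂ (n := n))).apply_symm_apply _).symm

/-- the matrix of `u ∈ N_Δ(𝔸)` through a ring homomorphism `f` (a place component, the archimedean part): `reindex e₂ e₂ (1 − f X, f X; −f X, 1 + f X)`.
[cite: CasselsFrohlichANT1967, Ch. II §14] -/
theorem map_coe_eq_of_mem_unipDelta {S : Type*} [CommRing S] (f : AdeleRing (𝓞 L) L →+* S) {u : HA L e dV hdV dW hdW} (hu : u ∈ unipDelta L e dV hdV dW hdW) :
    (((u : HA L e dV hdV dW hdW) : GL (Fin (n + n)) (AdeleRing (𝓞 L) L)) : Matrix (Fin (n + n)) (Fin (n + n)) (AdeleRing (𝓞 L) L)).map f =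
      Matrix.reindex (e₂ (n := n)) (e₂ (n := n))
        (Matrix.fromBlocks (1 - ((blk L e dV hdV dW hdW u).toBlocks₁₂).map f) (((blk L e dV hdV dW hdW u).toBlocks₁₂).map f)
          (-((blk L e dV hdV dW hdW u).toBlocks₁₂).map f) (1 + ((blk L e dV hdV dW hdW u).toBlocks₁₂).map f)) := by
  rw [coe_eq_reindex_fromBlocks_of_mem_unipDelta L e dV hdV dW hdW hu, Matrix.reindex_apply, Matrix.reindex_apply, ← Matrix.submatrix_map, Matrix.fromBlocks_map,
    ← RingHom.mapMatrix_apply, ← RingHom.mapMatrix_apply, ← RingHom.mapMatrix_apply, ← RingHom.mapMatrix_apply, map_sub, map_one, map_neg, map_add, map_one]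

/-- a component (or the archimedean part) of `u ∈ N_Δ(𝔸)` at which the block coordinate vanishes is the IDENTITY matrix. [cite: CasselsFrohlichANT1967, Ch. II §14] -/
theorem map_coe_eq_one_of_map_eq_zero {S : Type*} [CommRing S] (f : AdeleRing (𝓞 L) L →+* S) {u : HA L e dV hdV dW hdW} (hu : u ∈ unipDelta L e dV hdV dW hdW)
    (h0 : ((blk L e dV hdV dW hdW u).toBlocks₁₂).map f = 0) :
    (((u : HA L e dV hdV dW hdW) : GL (Fin (n + n)) (AdeleRing (𝓞 L) L)) : Matrix (Fin (n + n)) (Fin (n + n)) (AdeleRing (𝓞 L) L)).map f = 1 := by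
  rw [map_coe_eq_of_mem_unipDelta L e dV hdV dW hdW f hu, h0, sub_zero, neg_zero, add_zero, Matrix.fromBlocks_one, Matrix.reindex_apply, Matrix.submatrix_one_equiv]

/-! ## §2 Matrices over `𝔸_L` are determined by their archimedean part and their finite-place components -/

omit [IsCMField L] in
/-- two matrices over `𝔸_L` agree iff their archimedean parts and their components at every finite place agree. [cite: CasselsFrohlichANT1967, Ch. II §14] -/
theorem matrix_adele_ext_of_places {ι : Type*} {A B : Matrix ι ι (AdeleRing (𝓞 L) L)}
    (h₁ : A.map (UnitaryGroup.adeleFst L) = B.map (UnitaryGroup.adeleFst L))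
    (h₂ : ∀ w : HeightOneSpectrum (𝓞 L), A.map (AdelicGroupData.adeleEval L w) = B.map (AdelicGroupData.adeleEval L w)) : A = B :=
  Matrix.ext fun i j => Prod.ext (congrFun (congrFun h₁ i) j) (RestrictedProduct.ext _ _ fun w => congrFun (congrFun (h₂ w) i) j)

/-! ## §3 A Siegel unipotent supported over `v` IS the place inclusion of its `v`-component -/

variable (v : HeightOneSpectrum (𝓞 (Fp L)))

/-- **`ι_v ((u_f)_v) = u`** for `u ∈ N_Δ(𝔸)` whose block coordinate has zero archimedean part and zero component at every finite place not over `v`: both sides have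
archimedean part `1` (★ (d1) `map_fst_locToAdelic`, §1) and the same component at every finite place (★ (d1) `map_adeleEval_locToAdelic_of_over ∕ _of_not_over`,
`map_adeleEval_eq_evalPlace`, §1). [cite: CasselsFrohlichANT1967, Ch. II §14] [cite: BorelJacquet1979, §4.1] -/
theorem locToAdelic_evalPlace_finPart_eq_of_mem_unipDelta {u : HA L e dV hdV dW hdW} (hu : u ∈ unipDelta L e dV hdV dW hdW)
    (hfst : ((blk L e dV hdV dW hdW u).toBlocks₁₂).map (UnitaryGroup.adeleFst L) = 0)
    (hoff : ∀ w : HeightOneSpectrum (𝓞 L), w.under (𝓞 (Fp L)) ≠ v → ((blk L e dV hdV dW hdW u).toBlocks₁₂).map (AdelicGroupData.adeleEval L w) = 0) :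
    locToAdelic L e dV hdV dW hdW v
        (UnitaryGroup.evalPlace (Fp L) L (IsCMField.complexConj L) (n + n) (hermD L e dV hdV dW hdW) v
          (UnitaryGroup.finPart (Fp L) L (IsCMField.complexConj L) (n + n) (hermD L e dV hdV dW hdW) u)) = u := by
  apply Subtype.ext
  apply Units.ext
  refine matrix_adele_ext_of_places L ?_ fun w => ?_
  · exact (map_fst_locToAdelic L e dV hdV dW hdW v _).trans (map_coe_eq_one_of_map_eq_zero L e dV hdV dW hdW (UnitaryGroup.adeleFst L) hu hfst).symm
  · by_cases hw : w.under (𝓞 (Fp L)) = v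
    · exact (map_adeleEval_locToAdelic_of_over L e dV hdV dW hdW v _ ⟨w, hw⟩).trans (map_adeleEval_eq_evalPlace L e dV hdV dW hdW v u ⟨w, hw⟩).symm
    · exact (map_adeleEval_locToAdelic_of_not_over L e dV hdV dW hdW v _ w hw).trans
        (map_coe_eq_one_of_map_eq_zero L e dV hdV dW hdW (AdelicGroupData.adeleEval L w) hu (hoff w hw)).symm

/-- **LOCALISATION**: a Siegel unipotent `u ∈ N_Δ(𝔸)` supported over `v` (as in the previous theorem) is `ι_v z` for a LOCAL unipotent `z ∈ N_Δ(L⁺_v)` (namely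
`z = (u_f)_v`, ★ Φ3b `evalPlace_finPart_mem_unipDeltaLoc`). [cite: MoeglinWaldspurger1995, I.2.1] [cite: BorelJacquet1979, §4.1] -/
theorem exists_mem_unipDeltaLoc_locToAdelic_eq {u : HA L e dV hdV dW hdW} (hu : u ∈ unipDelta L e dV hdV dW hdW)
    (hfst : ((blk L e dV hdV dW hdW u).toBlocks₁₂).map (UnitaryGroup.adeleFst L) = 0)
    (hoff : ∀ w : HeightOneSpectrum (𝓞 L), w.under (𝓞 (Fp L)) ≠ v → ((blk L e dV hdV dW hdW u).toBlocks₁₂).map (AdelicGroupData.adeleEval L w) = 0) :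
    ∃ z ∈ unipDeltaLoc L e dV hdV dW hdW v, locToAdelic L e dV hdV dW hdW v z = u :=
  ⟨_, evalPlace_finPart_mem_unipDeltaLoc L e dV hdV dW hdW hu v, locToAdelic_evalPlace_finPart_eq_of_mem_unipDelta L e dV hdV dW hdW v hu hfst hoff⟩

/-! ## §4 The local chart: every admissible block supported over `v` is the coordinate of a local Siegel unipotent -/

/-- **THE LOCAL UNIPOTENT CHART AT `v`.**  Let `X ∈ M_n(𝔸_L)` be `T_𝔸`-skew-hermitian (`T_𝔸 X + σ(X)ᵀ T_𝔸 = 0`, the hypothesis of ★ `exists_unipChart`) with zero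
archimedean part and zero component at every finite place of `L` not over `v`.  Then there is a local Siegel unipotent `z ∈ N_Δ(L⁺_v)` whose place inclusion
`ι_v z ∈ N_Δ(𝔸)` has block coordinate `X(ι_v z) = X` — so the block coordinate is ONTO the admissible blocks at `v` (the input of ★ U2a's letter `hb`), in the
coordinates of ★ (d1) `unipDeltaChar_locToAdelic_eq_prod`. [cite: GelbartPiatetskishapiroRallis1987, Part A §1] [cite: HarrisKudlaSweet1996, §1 (1.12)]
[cite: MoeglinWaldspurger1995, I.2.1] -/
theorem exists_mem_unipDeltaLoc_toBlocks₁₂_eq (X : Matrix (Fin n) (Fin n) (AdeleRing (𝓞 L) L))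
    (hX : (gramR L e dV hdV dW hdW).map ((algebraMap L (AdeleRing (𝓞 L) L)).comp (algebraMap (Fp L) L)) * X +
        (X.map (conjAdele (Fp L) L (IsCMField.complexConj L)))ᵀ *
          (gramR L e dV hdV dW hdW).map ((algebraMap L (AdeleRing (𝓞 L) L)).comp (algebraMap (Fp L) L)) = 0)
    (hfst : X.map (UnitaryGroup.adeleFst L) = 0)
    (hoff : ∀ w : HeightOneSpectrum (𝓞 L), w.under (𝓞 (Fp L)) ≠ v → X.map (AdelicGroupData.adeleEval L w) = 0) :
    ∃ z ∈ unipDeltaLoc L e dV hdV dW hdW v, locToAdelic L e dV hdV dW hdW v z ∈ unipDelta L e dV hdV dW hdW ∧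
      (blk L e dV hdV dW hdW (locToAdelic L e dV hdV dW hdW v z)).toBlocks₁₂ = X := by
  obtain ⟨φ, -, -, hφ, -, -⟩ := exists_unipChart L e dV hdV dW hdW
  obtain ⟨hmem, hunip, hframe⟩ := hφ X hX
  -- the block coordinate of `n(X)` is `X`
  have hblk : (blk L e dV hdV dW hdW ⟨φ X, hmem⟩).toBlocks₁₂ = X := by
    have h := (mem_unipDelta_iff_conj L e dV hdV dW hdW ⟨φ X, hmem⟩).1 hunip
    rw [hframe] at h
    exact ((Matrix.fromBlocks_inj.1 h).2.1).symm
  obtain ⟨z, hz, hzu⟩ := exists_mem_unipDeltaLoc_locToAdelic_eq L e dV hdV dW hdW v hunip (by rw [hblk]; exact hfst) (by rw [hblk]; exact hoff)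
  refine ⟨z, hz, ?_, ?_⟩
  · rw [hzu]; exact hunip
  · rw [hzu]; exact hblk

end Summit.HodgeConjecture.HodgeConjecture.Cruxes.HLiu418.K2LiuUnipotentChartLocal

end
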